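import Summits.CriticalPhenomena.CardyFormulaZ2.Theorems.CardyMeckeFlipLawToCrossingsLowerPrelims
import Summits.CriticalPhenomena.CardyFormulaZ2.Theorems.CardyMagicRigidityLoopsToCrossingsStubDiscreteCrossingOfPathIn
import HarnessLib

/-!
# Line `registered`, stub 2: a crossing of the longer-and-narrower quad of `R` is a G02 crossing

Crux `Summit.CriticalPhenomena.CardyFormulaZ2.Theses.CardyBondTriangular.DiscretisationBridge`
(stmt-CriticalPhenomena-0787, shared with `…CardyIsoradial.DiscretisationBridge`), line
`registered`, stub `stub_crossed_subset_discrete` — the PORT between the Schramm–Smirnov encoding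
`ω ↦ S_ω ∈ ℋ_ℂ` of critical bond percolation on `δℤ²` and G02's crossing event `discreteCrossing`
(largest mesh component `Ω_δ`, distance-comparison discrete arcs).

Let `Φ` be a square model of the conformal rectangle `R` (`IsSquareModel`), `H = (i·) ∘ Φ`, and
`Q_{a,b} = rectQuad H a b` (so `Q_{1,1}` is the quad of `R`; `Q⁺ = Q_{1+s,1-s}` pokes out of `Ω̄`
across the arcs `0, 2` and keeps off the arcs `1, 3`). **For `0 < s < 1` and all small `δ`,
`Q⁺ ∈ S_ω` forces `ω ∈ discreteCrossing Ω δ (arc 0) (arc 2)`**: `Q⁺ ∈ S_ω` gives a crossing `K`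
of the slightly easier `Q_{1+t,1-s/2}` (`t ≤ s/2` so small that the two plates
`H([1, 1+t] × [-(1-s/2), 1-s/2])`, `H([-(1+t), -1] × …)` lie within half the plate margin of the
arcs `2`, `0`) inside the drawn open edges (`Quad.exists_isCrossing_of_mem_closure`); in the graph
of open edges drawn through `K` (`reachable_of_mem_edgePairs`) walk from an edge through the left
side of that quad (off `Ω̄`, near `arc 0`) to an edge through its right side; all vertices of the
walk are within `δ` of `K`, hence off-`Ω` vertices are close to `arc 0 ∪ arc 2` and in-`Ω`
vertices keep one mesh off `arc 1 ∪ arc 3`, and the bond port of Bollobás–Riordan's Claim 19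
(`stub_discreteCrossing_of_pathIn`, tree) turns the walk into a G02 crossing.

References: O. Schramm, S. Smirnov, Ann. Probab. 39 (2011), §1.3 and proof of Lemma 5.1;
B. Bollobás, O. Riordan, *Percolation* (2006), Ch. 7, Claim 19 p. 192 and remark p. 195;
S. Smirnov, C. R. Acad. Sci. Paris 333 (2001), §2.
-/

noncomputable section

namespace Summit.CriticalPhenomena.CardyFormulaZ2.Cruxes.DiscretisationBridge.Birth

open Set Filter MeasureTheory Metric Complex
open scoped Topology unitInterval
open Literature.Probability.Percolation hiding cardyFunction
open Literature.Probability.Percolation.QuadCrossing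
open Literature.Probability.RandomPlanarGeometry hiding cardyFunction
open Literature.Probability.LatticeModels
open Summit.CriticalPhenomena.CardyFormulaZ2.Theorems.MeckeFlipBridge
open Summit.CriticalPhenomena.CardyFormulaZ2.Cruxes.LoopsToCrossings.OracleSandwich

/-- A walk in the graph of open edges drawn through `K` is an open `ℤ²`-path inside the sites
within `δ` of `K`. [folklore] -/
theorem pathIn_of_walk_edgePairs {δ : ℝ} (hδ : 0 < δ) {ω : BondConfig (Site 2)} {K : Set ℂ}
    {G : SimpleGraph (Site 2)} (hG : ∀ x y, G.Adj x y ↔ (x, y) ∈ edgePairs δ ω K) :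
    ∀ {u v : Site 2} (_ : G.Walk u v), u ∈ {x : Site 2 | ∃ k ∈ K, dist (meshPoint δ x) k ≤ δ} →
      PathIn (openGraph ω ⊓ zdGraph 2) {x : Site 2 | ∃ k ∈ K, dist (meshPoint δ x) k ≤ δ} u v := by
  intro u v W
  induction W with
  | nil => exact fun hu => PathIn.refl hu
  | @cons a b c hab W ih =>
    intro ha
    have hab' : (a, b) ∈ edgePairs δ ω K := (hG a b).1 hab
    obtain ⟨hadj, hω, k, hks, hkK⟩ := hab'
    have hb : b ∈ {x : Site 2 | ∃ k ∈ K, dist (meshPoint δ x) k ≤ δ} := by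
      refine ⟨k, hkK, ?_⟩
      have hsub : segment ℝ (meshPoint δ a) (meshPoint δ b) ⊆ closedBall (meshPoint δ b) δ :=
        (convex_closedBall _ _).segment_subset
          (by rw [mem_closedBall, dist_meshPoint_of_adj hadj, abs_of_pos hδ])
          (mem_closedBall_self hδ.le)
      have := hsub hks
      rw [mem_closedBall] at this
      rwa [dist_comm]
    have hstep : (openGraph ω ⊓ zdGraph 2).Adj a b :=
      (SimpleGraph.inf_adj _ _ _ _).2 ⟨(openGraph_adj _ _ _).2 ⟨hω, hadj.ne⟩, hadj⟩
    have htail := ih hb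
    exact ⟨ha, Relation.ReflTransGen.head ⟨hstep, hb⟩ htail.2⟩

/-- **Stub 2 of line `registered` (port: a crossing of the longer-and-narrower quad is a G02
crossing).** For a square model `Φ` of `R`, `H = (i·) ∘ Φ` and `0 < s < 1`: for all small `δ` and
every configuration `ω` with `Q_{1+s,1-s} = rectQuad H (1+s) (1-s) ∈ S_ω` (Schramm–Smirnov
encoding at mesh `δ`), `ω` has an open crossing of `Ω_δ` (largest mesh component) between the
discrete arcs of `R.arc 0`, `R.arc 2`. See the module docstring for the proof.
[cite: SchrammSmirnov2011, §1.3 and proof of Lemma 5.1]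
[cite: BollobasRiordan2006, Ch. 7 Claim 19 p. 192 and remark p. 195] -/
theorem stub_crossed_subset_discrete :
    ∀ (R : Literature.Probability.RandomPlanarGeometry.ConformalRectangle) (Φ : ℂ ≃ₜ ℂ),
      Literature.Probability.Percolation.IsSquareModel R Φ →
      ∀ (s : ℝ) (hs : 0 < s) (hs1 : s < 1),
        ∃ δ₀ : ℝ, 0 < δ₀ ∧ ∀ δ : ℝ, 0 < δ → δ < δ₀ →
          ∀ ω : Literature.Probability.Percolation.BondConfig
              (Literature.Probability.LatticeModels.Site 2),
            Literature.Probability.Percolation.QuadCrossing.Quad.rectQuad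
                ((Homeomorph.mulLeft₀ Complex.I Complex.I_ne_zero).trans Φ) (1 + s) (1 - s)
                (add_pos one_pos hs) (sub_pos.2 hs1) (fun _ => Set.mem_univ _) ∈
              Literature.Probability.Percolation.z2QuadConfig Set.univ δ ω →
            ω ∈ Literature.Probability.Percolation.discreteCrossing R.carrier δ (R.arc 0)
              (R.arc 2) := by
  intro R Φ h s hs hs1
  classical
  set H : ℂ ≃ₜ ℂ := (Homeomorph.mulLeft₀ Complex.I Complex.I_ne_zero).trans Φ with hH
  -- the bond port of Claim 19 and its constants
  obtain ⟨δA, hδA, tA, htA, hA⟩ := stub_discreteCrossing_of_pathIn R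
  -- uniform continuity of `H` on `C = [-2, 2]²` at precision `η = tA / 2`
  set η : ℝ := tA / 2 with hη
  have hηpos : 0 < η := by positivity
  set C : Set ℂ := Icc (-2 : ℝ) 2 ×ℂ Icc (-2 : ℝ) 2 with hC
  have hCc : IsCompact C := isCompact_Icc.reProdIm isCompact_Icc
  obtain ⟨θ, hθ, hHθ⟩ := Metric.uniformContinuousOn_iff.1
    (hCc.uniformContinuousOn_of_continuous H.continuous.continuousOn) η hηpos
  -- the intermediate quad `Q' = Q_{1+t,b}`, `t = min (s/2) (θ/2)`, `b = 1 - s/2`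
  set t : ℝ := min (s / 2) (θ / 2) with ht
  have ht0 : 0 < t := lt_min (by positivity) (by positivity)
  have hts : t ≤ s / 2 := min_le_left _ _
  have htθ : t < θ := (min_le_right _ _).trans_lt (by linarith)
  have ht1 : t < 1 := by linarith
  set b : ℝ := 1 - s / 2 with hb
  have hb0 : 0 < b := by rw [hb]; linarith
  have hb1 : b < 1 := by rw [hb]; linarith
  have hlt : Quad.StrictlyDominated
      (Quad.rectQuad H (1 + t) b (by linarith) hb0 (fun _ => mem_univ _))
      (Quad.rectQuad H (1 + s) (1 - s) (add_pos one_pos hs) (sub_pos.2 hs1) (fun _ => mem_univ _)) :=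
    Quad.strictlyDominated_rectQuad H (by linarith) (by linarith) (sub_pos.2 hs1)
      (by rw [hb]; linarith) _ _
  -- the compact pieces: the band `B = [Q']` and its two outer sides `Sd`
  set B : Set ℂ := H '' (Icc (-(1 + t)) (1 + t) ×ℂ Icc (-b) b) with hB
  set Sd : Set ℂ := H '' {w : ℂ | (w.re = -(1 + t) ∨ w.re = 1 + t) ∧ w.im ∈ Icc (-b) b} with hSd
  have hBc : IsCompact B := (isCompact_Icc.reProdIm isCompact_Icc).image H.continuous
  have hSdc : IsCompact Sd := by
    have : {w : ℂ | (w.re = -(1 + t) ∨ w.re = 1 + t) ∧ w.im ∈ Icc (-b) b} =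
        ({-(1 + t)} ×ℂ Icc (-b) b) ∪ ({1 + t} ×ℂ Icc (-b) b) := by
      ext w; simp only [mem_setOf_eq, mem_union, mem_reProdIm, mem_singleton_iff]; tauto
    rw [hSd, this]
    exact ((isCompact_singleton.reProdIm isCompact_Icc).union
      (isCompact_singleton.reProdIm isCompact_Icc)).image H.continuous
  -- (1) the band is at positive distance `d13` from the arcs `1`, `3`
  obtain ⟨d13, hd13, h13⟩ : ∃ d : ℝ, 0 < d ∧ ∀ a ∈ B, ∀ z ∈ R.arc 1 ∪ R.arc 3, d < dist a z := by
    refine exists_pos_forall_lt_dist_of_disjoint hBc ((R.isClosed_arc 1).union (R.isClosed_arc 3)) ?_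
    rw [hB, ← side_one_quadOf h, ← side_three_quadOf h, side_one_rq, side_three_rq,
      disjoint_iff_forall_ne]
    rintro _ ⟨w, hw, rfl⟩ _ hz heq
    rcases hz with ⟨w', hw', hw'e⟩ | ⟨w', hw', hw'e⟩
    · have := H.injective (heq.trans hw'e.symm); subst this
      rw [mem_reProdIm, mem_Icc, mem_Icc] at hw
      linarith [hw.2.1, hw'.1]
    · have := H.injective (heq.trans hw'e.symm); subst this
      rw [mem_reProdIm, mem_Icc, mem_Icc] at hw
      linarith [hw.2.2, hw'.1]
  -- (2) the outer sides are at positive distance `dout` from the closed quad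
  obtain ⟨dout, hdout, hout⟩ : ∃ d : ℝ, 0 < d ∧ ∀ a ∈ Sd, ∀ z ∈ closure R.carrier, d < dist a z := by
    refine exists_pos_forall_lt_dist_of_disjoint hSdc isClosed_closure ?_
    rw [hSd, disjoint_iff_forall_ne]
    rintro _ ⟨w, hw, rfl⟩ z hz heq
    rw [← heq] at hz
    have hz' := (apply_mem_closure_iff h w).1 hz
    rw [mem_reProdIm, mem_Icc] at hz'
    rcases hw.1 with h1 | h1 <;> rw [h1] at hz' <;> linarith [hz'.1.1, hz'.1.2]
  -- (3) points of the two plates are `η`-close to the arcs `0`, `2`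
  have harc0 : R.arc 0 = H '' {w : ℂ | w.re = -1 ∧ w.im ∈ Icc (-1 : ℝ) 1} := by
    rw [← side_zero_quadOf h, side_zero_rq]
  have harc2 : R.arc 2 = H '' {w : ℂ | w.re = 1 ∧ w.im ∈ Icc (-1 : ℝ) 1} := by
    rw [← side_two_quadOf h, side_two_rq]
  have hplate : ∀ w : ℂ, w ∈ Icc (-(1 + t)) (1 + t) ×ℂ Icc (-b) b →
      w ∉ Ioo (-1 : ℝ) 1 ×ℂ Ioo (-1 : ℝ) 1 →
      infDist (H w) (R.arc 0) < η ∨ infDist (H w) (R.arc 2) < η := by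
    intro w hw hwout
    rw [mem_reProdIm, mem_Icc, mem_Icc] at hw
    have him : w.im ∈ Icc (-1 : ℝ) 1 := ⟨by linarith [hw.2.1], by linarith [hw.2.2]⟩
    have hre : w.re ≤ -1 ∨ 1 ≤ w.re := by
      by_contra hcon
      push Not at hcon
      exact hwout ⟨⟨hcon.1, hcon.2⟩, ⟨by linarith [hw.2.1], by linarith [hw.2.2]⟩⟩
    have hwC : w ∈ C := by
      rw [hC, mem_reProdIm, mem_Icc, mem_Icc]
      exact ⟨⟨by linarith [hw.1.1], by linarith [hw.1.2]⟩, by linarith [hw.2.1], by linarith [hw.2.2]⟩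
    rcases hre with hre | hre
    · left
      obtain ⟨w', hw're, hw'im⟩ : ∃ w' : ℂ, w'.re = -1 ∧ w'.im = w.im := ⟨⟨-1, w.im⟩, rfl, rfl⟩
      have hw'C : w' ∈ C := by
        rw [hC, mem_reProdIm, mem_Icc, mem_Icc, hw're, hw'im]
        exact ⟨⟨by norm_num, by norm_num⟩, by linarith [him.1], by linarith [him.2]⟩
      have hd : dist w w' < θ := by
        rw [Complex.dist_of_im_eq hw'im.symm, Real.dist_eq, hw're, abs_of_nonpos (by linarith)]
        linarith [hw.1.1]
      have hmem : H w' ∈ R.arc 0 := by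
        rw [harc0]; exact mem_image_of_mem _ ⟨hw're, by rw [hw'im]; exact him⟩
      calc infDist (H w) (R.arc 0) ≤ dist (H w) (H w') := infDist_le_dist_of_mem hmem
        _ < η := hHθ w hwC w' hw'C hd
    · right
      obtain ⟨w', hw're, hw'im⟩ : ∃ w' : ℂ, w'.re = 1 ∧ w'.im = w.im := ⟨⟨1, w.im⟩, rfl, rfl⟩
      have hw'C : w' ∈ C := by
        rw [hC, mem_reProdIm, mem_Icc, mem_Icc, hw're, hw'im]
        exact ⟨⟨by norm_num, by norm_num⟩, by linarith [him.1], by linarith [him.2]⟩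
      have hd : dist w w' < θ := by
        rw [Complex.dist_of_im_eq hw'im.symm, Real.dist_eq, hw're, abs_of_nonneg (by linarith)]
        linarith [hw.1.2]
      have hmem : H w' ∈ R.arc 2 := by
        rw [harc2]; exact mem_image_of_mem _ ⟨hw're, by rw [hw'im]; exact him⟩
      calc infDist (H w) (R.arc 2) ≤ dist (H w) (H w') := infDist_le_dist_of_mem hmem
        _ < η := hHθ w hwC w' hw'C hd
  -- frontier points lie on the arcs
  have hfr : frontier R.carrier ⊆ R.arc 0 ∪ R.arc 2 ∪ (R.arc 1 ∪ R.arc 3) := by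
    intro z hz
    rw [← R.iUnion_arc_holds] at hz
    obtain ⟨i, hi⟩ := mem_iUnion.1 hz
    fin_cases i
    · exact Or.inl (Or.inl hi)
    · exact Or.inr (Or.inl hi)
    · exact Or.inl (Or.inr hi)
    · exact Or.inr (Or.inr hi)
  -- the mesh threshold
  refine ⟨min (min δA (tA / 2)) (min d13 dout) / 4, by positivity, ?_⟩
  intro δ hδ hδlt ω hmem
  have hδA' : δ < δA := by
    have := min_le_left (min δA (tA / 2)) (min d13 dout); have := min_le_left δA (tA / 2); linarith
  have hδt : 2 * δ ≤ tA := by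
    have := min_le_left (min δA (tA / 2)) (min d13 dout); have := min_le_right δA (tA / 2); linarith
  have hδ13 : 4 * δ < d13 := by
    have := min_le_right (min δA (tA / 2)) (min d13 dout); have := min_le_left d13 dout; linarith
  have hδout : 4 * δ < dout := by
    have := min_le_right (min δA (tA / 2)) (min d13 dout); have := min_le_right d13 dout; linarith
  -- a crossing `K` of `Q'` inside the open edges
  set O : Set ℂ := openEdgeUnion δ ω with hO
  have hmem' : Quad.rectQuad H (1 + s) (1 - s) (add_pos one_pos hs) (sub_pos.2 hs1)
      (fun _ => mem_univ _) ∈ closure {Q : Quad (univ : Set ℂ) | ∃ K, Q.IsCrossing K ∧ K ⊆ O} := by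
    rw [← coe_z2QuadConfig]; exact hmem
  obtain ⟨K, ⟨hKc, hKconn, hKQ, hK0, hK2⟩, hKO⟩ := Quad.exists_isCrossing_of_mem_closure hlt hmem'
  have hKB : K ⊆ B := by rw [hB, ← carrier_rq H]; exact hKQ
  -- segments of adjacent mesh points stay within `δ` of both ends
  have hseg_le : ∀ {x y : Site 2}, (zdGraph 2).Adj x y →
      ∀ z ∈ segment ℝ (meshPoint δ x) (meshPoint δ y), dist z (meshPoint δ x) ≤ δ ∧
        dist z (meshPoint δ y) ≤ δ := by
    intro x y hxy z hz
    have hxy' : dist (meshPoint δ x) (meshPoint δ y) = δ := by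
      rw [dist_meshPoint_of_adj hxy, abs_of_pos hδ]
    constructor
    · have hsub : segment ℝ (meshPoint δ x) (meshPoint δ y) ⊆ closedBall (meshPoint δ x) δ :=
        (convex_closedBall _ _).segment_subset (mem_closedBall_self hδ.le)
          (by rw [mem_closedBall, dist_comm, hxy'])
      exact mem_closedBall.1 (hsub hz)
    · have hsub : segment ℝ (meshPoint δ x) (meshPoint δ y) ⊆ closedBall (meshPoint δ y) δ :=
        (convex_closedBall _ _).segment_subset (by rw [mem_closedBall, hxy']) (mem_closedBall_self hδ.le)
      exact mem_closedBall.1 (hsub hz)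
  -- the site set of the port: sites within `δ` of `K`
  set S : Set (Site 2) := {x : Site 2 | ∃ k ∈ K, dist (meshPoint δ x) k ≤ δ} with hS
  -- (i) off-`Ω` sites of `S` are `tA`-close to `arc 0 ∪ arc 2`
  have hSout : ∀ x ∈ S, meshPoint δ x ∉ R.carrier →
      infDist (meshPoint δ x) (R.arc 0) ≤ tA ∨ infDist (meshPoint δ x) (R.arc 2) ≤ tA := by
    rintro x ⟨k, hkK, hxk⟩ hxout
    obtain ⟨w, hw, rfl⟩ := hKB hkK
    by_cases hk : H w ∈ R.carrier
    · -- the segment from `H w ∈ Ω` to the site meets the frontier within `δ` of the site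
      have hsc : IsPreconnected (segment ℝ (H w) (meshPoint δ x)) := (convex_segment _ _).isPreconnected
      obtain ⟨f, hfs, hff⟩ := Literature.Algebra.EuclideanLattices.isPreconnected_inter_frontier_nonempty
        hsc ⟨_, left_mem_segment _ _ _, hk⟩ ⟨_, right_mem_segment _ _ _, hxout⟩
      have hsub : segment ℝ (H w) (meshPoint δ x) ⊆ closedBall (meshPoint δ x) δ :=
        (convex_closedBall _ _).segment_subset (by rw [mem_closedBall, dist_comm]; exact hxk)
          (mem_closedBall_self hδ.le)
      have hfx : dist f (meshPoint δ x) ≤ δ := mem_closedBall.1 (hsub hfs)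
      rcases hfr hff with hf | hf
      · rcases hf with hf | hf
        · left
          calc infDist (meshPoint δ x) (R.arc 0) ≤ dist (meshPoint δ x) f := infDist_le_dist_of_mem hf
            _ ≤ δ := by rw [dist_comm]; exact hfx
            _ ≤ tA := by linarith
        · right
          calc infDist (meshPoint δ x) (R.arc 2) ≤ dist (meshPoint δ x) f := infDist_le_dist_of_mem hf
            _ ≤ δ := by rw [dist_comm]; exact hfx
            _ ≤ tA := by linarith
      · exfalso
        have hkf : dist (H w) f ≤ 2 * δ := by
          calc dist (H w) f ≤ dist (H w) (meshPoint δ x) + dist (meshPoint δ x) f := dist_triangle _ _ _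
            _ ≤ δ + δ := add_le_add (by rw [dist_comm]; exact hxk) (by rw [dist_comm]; exact hfx)
            _ = 2 * δ := by ring
        have := h13 (H w) (hKB hkK) f hf
        linarith
    · -- `H w` is on a plate, `η`-close to an arc
      have hwout : w ∉ Ioo (-1 : ℝ) 1 ×ℂ Ioo (-1 : ℝ) 1 := fun hwin =>
        hk ((apply_mem_carrier_iff h w).2 hwin)
      rcases hplate w hw hwout with hw0 | hw2
      · left
        have := infDist_le_infDist_add_dist (s := R.arc 0) (x := meshPoint δ x) (y := H w)
        linarith
      · right
        have := infDist_le_infDist_add_dist (s := R.arc 2) (x := meshPoint δ x) (y := H w)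
        linarith
  -- (ii) in-`Ω` sites of `S` keep one mesh off `arc 1 ∪ arc 3`
  have hSin : ∀ x ∈ S, meshPoint δ x ∈ R.carrier →
      δ < infDist (meshPoint δ x) (R.arc 1) ∧ δ < infDist (meshPoint δ x) (R.arc 3) := by
    rintro x ⟨k, hkK, hxk⟩ -
    have hne1 : (R.arc 1).Nonempty := ⟨_, R.pt_mem_arc_self 1⟩
    have hne3 : (R.arc 3).Nonempty := ⟨_, R.pt_mem_arc_self 3⟩
    constructor
    · have key : 2 * δ ≤ infDist (meshPoint δ x) (R.arc 1) := by
        refine (le_infDist hne1).2 fun z hz => ?_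
        have h1 := h13 k (hKB hkK) z (Or.inl hz)
        have h2 := dist_triangle k (meshPoint δ x) z
        rw [dist_comm k (meshPoint δ x)] at h2
        linarith
      linarith
    · have key : 2 * δ ≤ infDist (meshPoint δ x) (R.arc 3) := by
        refine (le_infDist hne3).2 fun z hz => ?_
        have h1 := h13 k (hKB hkK) z (Or.inr hz)
        have h2 := dist_triangle k (meshPoint δ x) z
        rw [dist_comm k (meshPoint δ x)] at h2
        linarith
      linarith
  -- the two end edge pairs, through the left and right sides of `Q'`
  obtain ⟨k₀, hk₀K, hk₀s⟩ := hK0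
  obtain ⟨k₂, hk₂K, hk₂s⟩ := hK2
  obtain ⟨e₀, he₀, hke₀⟩ := exists_mem_edgePairs_of_mem hKO hk₀K
  obtain ⟨e₂, he₂, hke₂⟩ := exists_mem_edgePairs_of_mem hKO hk₂K
  rw [side_zero_rq] at hk₀s
  rw [side_two_rq] at hk₂s
  obtain ⟨w₀, ⟨hw₀re, hw₀im⟩, hw₀k⟩ := hk₀s
  obtain ⟨w₂, ⟨hw₂re, hw₂im⟩, hw₂k⟩ := hk₂s
  rw [mem_Icc] at hw₀im hw₂im
  have hk₀S : k₀ ∈ Sd := by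
    rw [← hw₀k]; exact mem_image_of_mem _ ⟨Or.inl hw₀re, mem_Icc.2 hw₀im⟩
  have hk₂S : k₂ ∈ Sd := by
    rw [← hw₂k]; exact mem_image_of_mem _ ⟨Or.inr hw₂re, mem_Icc.2 hw₂im⟩
  -- their first ends are off `Ω`, within `δ` of `k₀`, `k₂`
  have he₀d : dist (meshPoint δ e₀.1) k₀ ≤ δ := by
    rw [dist_comm]; exact (hseg_le he₀.1 k₀ hke₀).1
  have he₂d : dist (meshPoint δ e₂.1) k₂ ≤ δ := by
    rw [dist_comm]; exact (hseg_le he₂.1 k₂ hke₂).1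
  have he₀out : meshPoint δ e₀.1 ∉ R.carrier := fun hin => by
    have := hout k₀ hk₀S _ (subset_closure hin)
    rw [dist_comm] at he₀d
    linarith
  have he₂out : meshPoint δ e₂.1 ∉ R.carrier := fun hin => by
    have := hout k₂ hk₂S _ (subset_closure hin)
    rw [dist_comm] at he₂d
    linarith
  -- and close to the arcs `0`, `2`
  have hw₀C : w₀ ∈ C := by
    rw [hC, mem_reProdIm, mem_Icc, mem_Icc, hw₀re]
    exact ⟨⟨by linarith, by linarith⟩, by linarith [hw₀im.1], by linarith [hw₀im.2]⟩
  have hw₂C : w₂ ∈ C := by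
    rw [hC, mem_reProdIm, mem_Icc, mem_Icc, hw₂re]
    exact ⟨⟨by linarith, by linarith⟩, by linarith [hw₂im.1], by linarith [hw₂im.2]⟩
  have he₀A : infDist (meshPoint δ e₀.1) (R.arc 0) ≤ tA := by
    have him : w₀.im ∈ Icc (-1 : ℝ) 1 := ⟨by linarith [hw₀im.1], by linarith [hw₀im.2]⟩
    obtain ⟨w', hw're, hw'im⟩ : ∃ w' : ℂ, w'.re = -1 ∧ w'.im = w₀.im := ⟨⟨-1, w₀.im⟩, rfl, rfl⟩
    have hw'C : w' ∈ C := by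
      rw [hC, mem_reProdIm, mem_Icc, mem_Icc, hw're, hw'im]
      exact ⟨⟨by norm_num, by norm_num⟩, by linarith [him.1], by linarith [him.2]⟩
    have hd : dist w₀ w' < θ := by
      rw [Complex.dist_of_im_eq hw'im.symm, Real.dist_eq, hw're, hw₀re,
        show -(1 + t) - -1 = -t by ring, abs_neg, abs_of_pos ht0]
      exact htθ
    have hmemA : H w' ∈ R.arc 0 := by
      rw [harc0]; exact mem_image_of_mem _ ⟨hw're, by rw [hw'im]; exact him⟩
    have h1 : infDist k₀ (R.arc 0) < η := by
      calc infDist k₀ (R.arc 0) ≤ dist k₀ (H w') := infDist_le_dist_of_mem hmemA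
        _ = dist (H w₀) (H w') := by rw [hw₀k]
        _ < η := hHθ w₀ hw₀C w' hw'C hd
    have h2 := infDist_le_infDist_add_dist (s := R.arc 0) (x := meshPoint δ e₀.1) (y := k₀)
    linarith
  have he₂A : infDist (meshPoint δ e₂.1) (R.arc 2) ≤ tA := by
    have him : w₂.im ∈ Icc (-1 : ℝ) 1 := ⟨by linarith [hw₂im.1], by linarith [hw₂im.2]⟩
    obtain ⟨w', hw're, hw'im⟩ : ∃ w' : ℂ, w'.re = 1 ∧ w'.im = w₂.im := ⟨⟨1, w₂.im⟩, rfl, rfl⟩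
    have hw'C : w' ∈ C := by
      rw [hC, mem_reProdIm, mem_Icc, mem_Icc, hw're, hw'im]
      exact ⟨⟨by norm_num, by norm_num⟩, by linarith [him.1], by linarith [him.2]⟩
    have hd : dist w₂ w' < θ := by
      rw [Complex.dist_of_im_eq hw'im.symm, Real.dist_eq, hw're, hw₂re,
        show (1 + t) - 1 = t by ring, abs_of_pos ht0]
      exact htθ
    have hmemA : H w' ∈ R.arc 2 := by
      rw [harc2]; exact mem_image_of_mem _ ⟨hw're, by rw [hw'im]; exact him⟩
    have h1 : infDist k₂ (R.arc 2) < η := by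
      calc infDist k₂ (R.arc 2) ≤ dist k₂ (H w') := infDist_le_dist_of_mem hmemA
        _ = dist (H w₂) (H w') := by rw [hw₂k]
        _ < η := hHθ w₂ hw₂C w' hw'C hd
    have h2 := infDist_le_infDist_add_dist (s := R.arc 2) (x := meshPoint δ e₂.1) (y := k₂)
    linarith
  -- the walk in the graph of open edges drawn through `K`, as an open path inside `S`
  let G : SimpleGraph (Site 2) :=
    { Adj := fun x y => (x, y) ∈ edgePairs δ ω K
      symm := ⟨fun x y hxy => swap_mem_edgePairs hxy⟩
      loopless := ⟨fun x hx => hx.1.ne rfl⟩ }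
  have hG : ∀ x y, G.Adj x y ↔ (x, y) ∈ edgePairs δ ω K := fun _ _ => Iff.rfl
  obtain ⟨W⟩ := reachable_of_mem_edgePairs hδ hKconn.isPreconnected hKc.isBounded hKO G hG he₀ he₂
  have he₀S : e₀.1 ∈ S := ⟨k₀, hk₀K, he₀d⟩
  have hP : PathIn (openGraph ω ⊓ zdGraph 2) S e₀.1 e₂.1 := pathIn_of_walk_edgePairs hδ hG W he₀S
  -- the port
  exact hA δ tA hδ hδA' htA.le le_rfl ω S e₀.1 e₂.1 hSout hSin he₀out he₀A he₂out he₂A hP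

end Summit.CriticalPhenomena.CardyFormulaZ2.Cruxes.DiscretisationBridge.Birth

end
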